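import Mathlib
import HarnessLib
import Summits.HubbardSuperconductivity.HubbardSuperconductivity.Theorems.KLProgrammePolarRayCoareaJacobian

/-!
# Route `KLProgramme` — K3 ENGINE child (stmt-HubbardSuperconductivity-20437 `KLRegimeEngineV17F2`), class #5 rev 3 (RELATIVE, cutoff-built family),
# the (F)(i) RE-FRAMING door, brick (Fa): TWO FRAMES `δ, δ′` — the frame LEVEL MAP `u_E(ν,θ) = perturbedFermiRadius δ ν θ`, the transversal
# slope `∂_tG` and the level-set Jacobian `𝒥_E(θ,ν)` move by `O(‖δ − δ′‖)` (cell gate-hubbard-kl, seat hubbard-kl-k3c2-p2 g13; plan g21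
# (R54t)(3) «(F) pricing»; KLTC-INDEX-v7 §C «(F)(i) re-framing value door [k3c2-p2/p2]»)

WHY.  A cutoff-built member `ψ^K(k) = f((k₀² + e_K(k)²)/Λ_m²)` of the relative transfer family (class #5 rev 3, `IsCutoffBuilt`) is LEVEL-BUILT: a
frame-independent profile `f` composed with the frame's level `e_K = ε₀ − μ − K`.  Re-framing `Kₙ → Kₙ₊₁` a smeared loop
`∫ d²k f(level_K(k))·F(k)` is therefore compared in the LEVEL COORDINATES of each frame (`klrf_integral_eq_frame_level_coords`, p467382):
`∫ dθ ∫ de 𝒥_K(θ,e)·f(e)·F(u_K(μ+e,θ)·dir θ)` — the profile is never differentiated, only the Jacobian `𝒥_K` and the evaluation point `u_K`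
move with `K`.  This brick quantifies those two motions for two perturbations `δ, δ′` of the free band (`δ = −K`), both admissible in p4's sense
(`C¹`, `|·| ≤ κ₀`, `‖D·‖ ≤ κ₁ < Dt_min` on the closed square), with `|δ − δ′| ≤ η` and `|Dδ[dir θ] − Dδ′[dir θ]| ≤ η₁` on the closed square:

* §1 **`klrg_level_reframe`** — `|u_{δ′}(ν,θ) − u_δ(ν,θ)| ≤ η/(Dt_min − κ₁)` at every admissible level `ν` (`a ≤ ν − κ₀`, `ν + κ₀ ≤ b`):
  the growth estimate `klrf_growth` of ONE frame between the two radii (no uniqueness argument, no derivative);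
  `klrg_point_reframe` — the curve points move by the same amount in the sup norm of `ℝ × ℝ`;
* §2 **`klrg_pertDt_reframe`** — `|∂_tG_δ(θ,u_δ) − ∂_tG_{δ′}(θ,u_{δ′})| ≤ (2 + κ₂)·η/(Dt_min − κ₁) + η₁` (`∂_tε₀` is 2-Lipschitz, `klrj_rayDispersionDt_lipschitz`;
  `κ₂` = the radial Lipschitz constant of `t ↦ Dδ(t·dir θ)[dir θ]`, as in `klrj_jacobian_lipschitz`);
* §3 **`klrg_jacobian_reframe`** — `|𝒥_δ(θ,ν) − 𝒥_{δ′}(θ,ν)| ≤ (1/d² + π√2(2+κ₂)/d³)·η + (π√2/d²)·η₁`, `d = Dt_min − κ₁` — the SAME constant as the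
  level-Lipschitz bound `klrj_jacobian_lipschitz`, plus the slope term.
CONSEQUENCE (priced on KL STATUS 2026-08-28 ≈00:24Z): with `η = ‖Kₙ₊₁ − Kₙ‖ ≤ Gfr₀·U·16^{−(n+1)}` ((I-F jets)) the re-framing defect of a level-built
smeared loop is `∝` its own level mass `‖f‖_{L¹(de)}` — i.e. ∝ the member's soft mass, uniformly in the member's depth `m` — and fits the `2^{−n}·ms`
unit of `transferBarRelAtWF_succ_room`.  Brick (Fb) (the planar re-framing inequality) and (Fc) (lattice / level-count twin) follow.

Pure analysis on the tree's objects (p4's `perturbedFermiRadius`, `BandBounds`); no definitions; nothing about the model is asserted; nothing asserts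
superconductivity.  References: BGM 2006 §2.4 Lemma 2.1 (2.40)–(2.41) [cite: BenfattoGiulianiMastropietro2006]; HOME/prover-p4/INVERSION-NOTE.md §2.
-/

noncomputable section

namespace Summit.HubbardSuperconductivity.HubbardSuperconductivity.Theorems.KLRegimeSplit

set_option linter.dupNamespace false -- summit = problem name (single-conjunct summit), D-0017

open Real Set Filter Literature.MathematicalPhysics.QuantumLattice
open Literature.MathematicalPhysics.QuantumLattice.BandSectorCounting
open Summit.HubbardSuperconductivity.HubbardSuperconductivity.Theorems.PerturbedFermiCurve

section TwoFrames

variable {a b : ℝ} (B : BandBounds a b) {δ δ' : (Fin 2 → ℝ) → ℝ} (hδ1 : ContDiff ℝ 1 δ) (hδ'1 : ContDiff ℝ 1 δ') {κ₀ κ₁ η : ℝ}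
  (hδ : ∀ k : Fin 2 → ℝ, (∀ i, |k i| ≤ π) → |δ k| ≤ κ₀) (hδ' : ∀ k : Fin 2 → ℝ, (∀ i, |k i| ≤ π) → |δ' k| ≤ κ₀)
  (hκ : ∀ k : Fin 2 → ℝ, (∀ i, |k i| ≤ π) → ‖fderiv ℝ δ k‖ ≤ κ₁) (hκ' : ∀ k : Fin 2 → ℝ, (∀ i, |k i| ≤ π) → ‖fderiv ℝ δ' k‖ ≤ κ₁)
  (hκ₁ : κ₁ < B.Dtmin) (hη : ∀ k : Fin 2 → ℝ, (∀ i, |k i| ≤ π) → |δ k - δ' k| ≤ η)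

/-! ## §1 The level map moves by `η/(Dt_min − κ₁)` -/

include B hδ1 hδ hδ' hκ hκ₁ hδ'1 hη in
/-- **Re-framing the level map**: for two admissible perturbations `δ, δ′` with `|δ − δ′| ≤ η` on the closed square and an admissible level `ν`
(`a ≤ ν − κ₀`, `ν + κ₀ ≤ b`), `|u_{δ′}(ν,θ) − u_δ(ν,θ)| ≤ η/(Dt_min − κ₁)`. -/
theorem klrg_level_reframe {ν : ℝ} (hν : a ≤ ν - κ₀) (hν' : ν + κ₀ ≤ b) (θ : ℝ) :
    |perturbedFermiRadius δ' ν θ - perturbedFermiRadius δ ν θ| ≤ η / (B.Dtmin - κ₁) := by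
  have hδc : Continuous δ := hδ1.continuous
  have hδ'c : Continuous δ' := hδ'1.continuous
  have hd : 0 < B.Dtmin - κ₁ := by linarith
  set u := perturbedFermiRadius δ ν θ with hu
  set u' := perturbedFermiRadius δ' ν θ with hu'
  have hR : IsBandFermiRadius (ν - δ (u • dir θ)) θ u := isBandFermiRadius_perturbedFermiRadius B hδc hδ hν hν' θ
  have hR' : IsBandFermiRadius (ν - δ' (u' • dir θ)) θ u' := isBandFermiRadius_perturbedFermiRadius B hδ'c hδ' hν hν' θ
  have hm := shiftedLevel_perturbedFermiRadius_mem_Icc B hδc hδ hν hν' θ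
  have hm' := shiftedLevel_perturbedFermiRadius_mem_Icc B hδ'c hδ' hν hν' θ
  have hG : rayDispersion (θ, u) + δ (u • dir θ) = ν := by have := hR.2; linarith
  have hG' : rayDispersion (θ, u') + δ' (u' • dir θ) = ν := by have := hR'.2; linarith
  -- the point `u' • dir θ` lies in the closed square, so `|δ − δ'| ≤ η` there
  have hsq : ∀ i, |(u' • dir θ) i| ≤ π := fun i => (abs_perturbedFermiRadius_smul_dir_lt B hδ'c hδ' hν hν' θ i).le
  have hηu : |δ (u' • dir θ) - δ' (u' • dir θ)| ≤ η := hη _ hsq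
  rw [le_div_iff₀ hd]
  rcases le_total u u' with h | h
  · -- `u ≤ u'`: growth of `G_δ` between `u` and `u'`
    have hg := klrf_growth B hδ1 hκ hR.1.1 h hR'.1.2 (by rw [hR.2]; exact hm.1) (by rw [hR'.2]; exact hm'.2)
    have he : rayDispersion (θ, u') + δ (u' • dir θ) - (rayDispersion (θ, u) + δ (u • dir θ)) = δ (u' • dir θ) - δ' (u' • dir θ) := by
      linarith
    rw [he] at hg
    rw [abs_of_nonneg (sub_nonneg.mpr h)]
    calc (u' - u) * (B.Dtmin - κ₁) = (B.Dtmin - κ₁) * (u' - u) := by ring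
      _ ≤ δ (u' • dir θ) - δ' (u' • dir θ) := hg
      _ ≤ η := (le_abs_self _).trans hηu
  · -- `u' ≤ u`
    have hg := klrf_growth B hδ1 hκ hR'.1.1 h hR.1.2 (by rw [hR'.2]; exact hm'.1) (by rw [hR.2]; exact hm.2)
    have he : rayDispersion (θ, u) + δ (u • dir θ) - (rayDispersion (θ, u') + δ (u' • dir θ)) = δ' (u' • dir θ) - δ (u' • dir θ) := by
      linarith
    rw [he] at hg
    rw [abs_of_nonpos (sub_nonpos.mpr h)]
    calc -(u' - u) * (B.Dtmin - κ₁) = (B.Dtmin - κ₁) * (u - u') := by ring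
      _ ≤ δ' (u' • dir θ) - δ (u' • dir θ) := hg
      _ ≤ η := (le_abs_self _).trans (by rw [abs_sub_comm]; exact hηu)

include B hδ1 hδ hδ' hκ hκ₁ hδ'1 hη in
/-- **The curve points move by `η/(Dt_min − κ₁)`** in the sup norm of `ℝ × ℝ`: `‖(u′cos θ, u′sin θ) − (u cos θ, u sin θ)‖ ≤ η/(Dt_min − κ₁)`. -/
theorem klrg_point_reframe {ν : ℝ} (hν : a ≤ ν - κ₀) (hν' : ν + κ₀ ≤ b) (θ : ℝ) :
    ‖((perturbedFermiRadius δ' ν θ * Real.cos θ, perturbedFermiRadius δ' ν θ * Real.sin θ) : ℝ × ℝ) -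
        (perturbedFermiRadius δ ν θ * Real.cos θ, perturbedFermiRadius δ ν θ * Real.sin θ)‖ ≤ η / (B.Dtmin - κ₁) := by
  have h := klrg_level_reframe B hδ1 hδ'1 hδ hδ' hκ hκ₁ hη hν hν' θ
  rw [Prod.mk_sub_mk, Prod.norm_def, ← sub_mul, ← sub_mul, Real.norm_eq_abs, Real.norm_eq_abs, abs_mul, abs_mul]
  refine max_le ?_ ?_
  · exact (mul_le_of_le_one_right (abs_nonneg _) (Real.abs_cos_le_one θ)).trans h
  · exact (mul_le_of_le_one_right (abs_nonneg _) (Real.abs_sin_le_one θ)).trans h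

/-! ## §2 The transversal slope moves by `(2 + κ₂)·η/d + η₁` -/

include B hδ1 hδ hδ' hκ hκ₁ hδ'1 hη in
/-- **Re-framing the transversal slope** `∂_tG_δ(θ,t) = ∂_tε₀(θ,t) + Dδ(t·dir θ)[dir θ]` at the two frames' own radii: with a radial Lipschitz bound `κ₂`
for `t ↦ Dδ(t·dir θ)[dir θ]` on the ray segment and `|Dδ[dir θ] − Dδ′[dir θ]| ≤ η₁` on the closed square,
`|∂_tG_δ(θ,u_δ) − ∂_tG_{δ′}(θ,u_{δ′})| ≤ (2 + κ₂)·η/(Dt_min − κ₁) + η₁`. -/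
theorem klrg_pertDt_reframe {κ₂ η₁ : ℝ} (hκ₂ : 0 ≤ κ₂) {θ : ℝ}
    (hD2 : ∀ s t : ℝ, s ∈ Icc 0 (π / ‖dir θ‖) → t ∈ Icc 0 (π / ‖dir θ‖) →
      |fderiv ℝ δ (s • dir θ) (dir θ) - fderiv ℝ δ (t • dir θ) (dir θ)| ≤ κ₂ * |s - t|)
    (hη₁ : ∀ k : Fin 2 → ℝ, (∀ i, |k i| ≤ π) → |fderiv ℝ δ k (dir θ) - fderiv ℝ δ' k (dir θ)| ≤ η₁)
    {ν : ℝ} (hν : a ≤ ν - κ₀) (hν' : ν + κ₀ ≤ b) :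
    |(rayDispersionDt θ (perturbedFermiRadius δ ν θ) + fderiv ℝ δ (perturbedFermiRadius δ ν θ • dir θ) (dir θ)) -
        (rayDispersionDt θ (perturbedFermiRadius δ' ν θ) + fderiv ℝ δ' (perturbedFermiRadius δ' ν θ • dir θ) (dir θ))| ≤
      (2 + κ₂) * (η / (B.Dtmin - κ₁)) + η₁ := by
  have hδc : Continuous δ := hδ1.continuous
  have hδ'c : Continuous δ' := hδ'1.continuous
  set u := perturbedFermiRadius δ ν θ with hu
  set u' := perturbedFermiRadius δ' ν θ with hu'
  have huI := perturbedFermiRadius_mem_Ioo B hδc hδ hν hν' θ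
  have hu'I := perturbedFermiRadius_mem_Ioo B hδ'c hδ' hν hν' θ
  have hL : |u - u'| ≤ η / (B.Dtmin - κ₁) := by
    rw [abs_sub_comm]; exact klrg_level_reframe B hδ1 hδ'1 hδ hδ' hκ hκ₁ hη hν hν' θ
  have hsq : ∀ i, |(u' • dir θ) i| ≤ π := fun i => (abs_perturbedFermiRadius_smul_dir_lt B hδ'c hδ' hν hν' θ i).le
  have h1 := klrj_rayDispersionDt_lipschitz θ u u'
  have h2 := hD2 u u' ⟨huI.1.le, huI.2.le⟩ ⟨hu'I.1.le, hu'I.2.le⟩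
  have h3 := hη₁ _ hsq
  have hsplit : (rayDispersionDt θ u + fderiv ℝ δ (u • dir θ) (dir θ)) - (rayDispersionDt θ u' + fderiv ℝ δ' (u' • dir θ) (dir θ)) =
      (rayDispersionDt θ u - rayDispersionDt θ u') + (fderiv ℝ δ (u • dir θ) (dir θ) - fderiv ℝ δ (u' • dir θ) (dir θ)) +
        (fderiv ℝ δ (u' • dir θ) (dir θ) - fderiv ℝ δ' (u' • dir θ) (dir θ)) := by ring
  rw [hsplit]
  calc |(rayDispersionDt θ u - rayDispersionDt θ u') + (fderiv ℝ δ (u • dir θ) (dir θ) - fderiv ℝ δ (u' • dir θ) (dir θ)) +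
          (fderiv ℝ δ (u' • dir θ) (dir θ) - fderiv ℝ δ' (u' • dir θ) (dir θ))|
        ≤ |rayDispersionDt θ u - rayDispersionDt θ u'| + |fderiv ℝ δ (u • dir θ) (dir θ) - fderiv ℝ δ (u' • dir θ) (dir θ)| +
          |fderiv ℝ δ (u' • dir θ) (dir θ) - fderiv ℝ δ' (u' • dir θ) (dir θ)| := abs_add_three _ _ _
    _ ≤ 2 * |u - u'| + κ₂ * |u - u'| + η₁ := add_le_add (add_le_add h1 h2) h3
    _ = (2 + κ₂) * |u - u'| + η₁ := by ring
    _ ≤ (2 + κ₂) * (η / (B.Dtmin - κ₁)) + η₁ := by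
      have := mul_le_mul_of_nonneg_left hL (by linarith : (0 : ℝ) ≤ 2 + κ₂)
      linarith

/-! ## §3 The Jacobian moves by `(1/d² + π√2(2+κ₂)/d³)·η + (π√2/d²)·η₁` -/

include B hδ1 hδ hδ' hκ hκ' hκ₁ hδ'1 hη in
/-- **Re-framing the level-set Jacobian** `𝒥_δ(θ,ν) = u_δ(ν,θ)·(∂_tG_δ(θ,u_δ(ν,θ)))⁻¹`: under the hypotheses of `klrg_pertDt_reframe`,
`|𝒥_δ(θ,ν) − 𝒥_{δ′}(θ,ν)| ≤ (1/d² + π√2·(2+κ₂)/d³)·η + (π√2/d²)·η₁`, `d = Dt_min − κ₁`. -/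
theorem klrg_jacobian_reframe {κ₂ η₁ : ℝ} (hκ₂ : 0 ≤ κ₂) {θ : ℝ}
    (hD2 : ∀ s t : ℝ, s ∈ Icc 0 (π / ‖dir θ‖) → t ∈ Icc 0 (π / ‖dir θ‖) →
      |fderiv ℝ δ (s • dir θ) (dir θ) - fderiv ℝ δ (t • dir θ) (dir θ)| ≤ κ₂ * |s - t|)
    (hη₁ : ∀ k : Fin 2 → ℝ, (∀ i, |k i| ≤ π) → |fderiv ℝ δ k (dir θ) - fderiv ℝ δ' k (dir θ)| ≤ η₁)
    {ν : ℝ} (hν : a ≤ ν - κ₀) (hν' : ν + κ₀ ≤ b) :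
    |perturbedFermiRadius δ ν θ *
          (rayDispersionDt θ (perturbedFermiRadius δ ν θ) + fderiv ℝ δ (perturbedFermiRadius δ ν θ • dir θ) (dir θ))⁻¹ -
        perturbedFermiRadius δ' ν θ *
          (rayDispersionDt θ (perturbedFermiRadius δ' ν θ) + fderiv ℝ δ' (perturbedFermiRadius δ' ν θ • dir θ) (dir θ))⁻¹| ≤
      (1 / (B.Dtmin - κ₁) ^ 2 + Real.pi * Real.sqrt 2 * (2 + κ₂) / (B.Dtmin - κ₁) ^ 3) * η +
        Real.pi * Real.sqrt 2 / (B.Dtmin - κ₁) ^ 2 * η₁ := by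
  have hδc : Continuous δ := hδ1.continuous
  have hδ'c : Continuous δ' := hδ'1.continuous
  set d := B.Dtmin - κ₁ with hd_def
  have hd : 0 < d := by rw [hd_def]; linarith
  set u := perturbedFermiRadius δ ν θ with hu_def
  set u' := perturbedFermiRadius δ' ν θ with hu'_def
  set D := rayDispersionDt θ u + fderiv ℝ δ (u • dir θ) (dir θ) with hD_def
  set D' := rayDispersionDt θ u' + fderiv ℝ δ' (u' • dir θ) (dir θ) with hD'_def
  have hDge : d ≤ D := klrf_pertDt_ge B hδ hκ hδc hν hν' θ
  have hD'ge : d ≤ D' := klrf_pertDt_ge B hδ' hκ' hδ'c hν hν' θ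
  have hDpos : 0 < D := hd.trans_le hDge
  have hD'pos : 0 < D' := hd.trans_le hD'ge
  have huI := perturbedFermiRadius_mem_Ioo B hδc hδ hν hν' θ
  have hu'I := perturbedFermiRadius_mem_Ioo B hδ'c hδ' hν hν' θ
  have hu'0 : 0 ≤ u' := hu'I.1.le
  have hu'le : u' ≤ Real.pi * Real.sqrt 2 := hu'I.2.le.trans (klrj_exit_le θ)
  -- η ≥ 0 and η₁ ≥ 0 (from the hypotheses at the origin)
  have hη0 : 0 ≤ η := (abs_nonneg _).trans (hη 0 (fun i => by simp [Real.pi_pos.le]))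
  have hη₁0 : 0 ≤ η₁ := (abs_nonneg _).trans (hη₁ 0 (fun i => by simp [Real.pi_pos.le]))
  -- the two motions
  have hL : |u - u'| ≤ η / d := by
    rw [abs_sub_comm]; exact klrg_level_reframe B hδ1 hδ'1 hδ hδ' hκ hκ₁ hη hν hν' θ
  have hDD : |D - D'| ≤ (2 + κ₂) * (η / d) + η₁ := klrg_pertDt_reframe B hδ1 hδ'1 hδ hδ' hκ hκ₁ hη hκ₂ hD2 hη₁ hν hν'
  -- split `u/D − u'/D' = (u − u')/D + u'(D' − D)/(DD')`
  have hsplit : u * D⁻¹ - u' * D'⁻¹ = (u - u') * D⁻¹ + u' * (D' - D) * (D⁻¹ * D'⁻¹) := by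
    field_simp; ring
  rw [hsplit]
  have hA : |(u - u') * D⁻¹| ≤ η / d * (1 / d) := by
    rw [abs_mul, abs_inv, abs_of_pos hDpos]
    exact mul_le_mul hL (by rw [one_div]; exact inv_anti₀ hd hDge) (inv_nonneg.mpr hDpos.le) (by positivity)
  have hB : |u' * (D' - D) * (D⁻¹ * D'⁻¹)| ≤ Real.pi * Real.sqrt 2 * ((2 + κ₂) * (η / d) + η₁) * (1 / d * (1 / d)) := by
    rw [abs_mul, abs_mul, abs_mul, abs_inv, abs_inv, abs_of_pos hDpos, abs_of_pos hD'pos, abs_of_nonneg hu'0, abs_sub_comm]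
    have h2 : D⁻¹ * D'⁻¹ ≤ 1 / d * (1 / d) := by
      rw [one_div]
      exact mul_le_mul (inv_anti₀ hd hDge) (inv_anti₀ hd hD'ge) (inv_nonneg.mpr hD'pos.le) (inv_nonneg.mpr hd.le)
    exact mul_le_mul (mul_le_mul hu'le hDD (abs_nonneg _) (by positivity)) h2 (by positivity) (by positivity)
  calc |(u - u') * D⁻¹ + u' * (D' - D) * (D⁻¹ * D'⁻¹)| ≤ |(u - u') * D⁻¹| + |u' * (D' - D) * (D⁻¹ * D'⁻¹)| := abs_add_le _ _
    _ ≤ η / d * (1 / d) + Real.pi * Real.sqrt 2 * ((2 + κ₂) * (η / d) + η₁) * (1 / d * (1 / d)) := add_le_add hA hB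
    _ = (1 / d ^ 2 + Real.pi * Real.sqrt 2 * (2 + κ₂) / d ^ 3) * η + Real.pi * Real.sqrt 2 / d ^ 2 * η₁ := by
      field_simp
      ring

end TwoFrames

end Summit.HubbardSuperconductivity.HubbardSuperconductivity.Theorems.KLRegimeSplit

end
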